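import Summits.Ventures.Crystal3D.Theorems.StickyWulffConstantNoReconstructionGainRegistry
import Summits.Ventures.Crystal3D.Theorems.StickyWulffConstantNoReconstructionGainMovedPlug
import Summits.Ventures.Crystal3D.Theorems.StickyWulffConstantNoReconstructionGainBlanketGlue
import HarnessLib

/-!
# Lattice-symmetry transport for `NoReconstructionGain`: one normal per `O_h`-orbit suffices

HONEST FRAMING. Part of the venture `Summits/Ventures/Crystal3D` (cell `crystal3d-full`), helper
`--supports` the crux `NoReconstructionGain` (stmt-Ventures-19144, route
`route-Ventures-StickyWulffConstant`), line `adhesion`.  Bookkeeping that every rung of this line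
has so far lacked: the crux body at a normal `ν` (sample = the `ν`-slab of the model fcc lattice
`Λ₀ = fccStacking 1 √(2/3)`, cost `2 φ(ν) π ρ² − C ρ` with the inlined
`φ(ν) = (√2/4) Σᶠ_{w ∈ Λ₀, ‖w‖ = 1} |⟪w, ν⟫|`) is TRANSPORTED along every linear isometry `g` of
`ℝ³` that maps `Λ₀` onto itself: if it holds at `ν` with constants `(R, C)` it holds at `g ν`
with the same constants (pull the configuration back through `g`; the sample, the contact
number and `φ` are invariant).  The same for the line's registered atom (Finset form,
`#cross(P, X∖P) ≤ contactDeficiency (X∖P) + C ρ`; cross count and deficiency are isometry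
invariants by `card_cross_image_of_isometry` / `contactDeficiency_image_of_isometry`).

The point group is generated inside the tree's vocabulary, with no coordinates: for sites
`p, q ∈ Λ₀` the number `2⟪p, q⟫` is an INTEGER (`two_inner_barlowPos_fcc`), so the mirror
orthogonal to any of the twelve bond vectors `w` (`‖w‖ = 1`, `w ∈ Λ₀`),
`p ↦ p − 2⟪w, p⟫ w = ((ℝ ∙ w)ᗮ).reflection p`, maps `Λ₀` into itself
(`bondReflection_mem_fcc`), and so does `p ↦ −p`; these mirrors generate the Weyl group of `D₃`
(order 24) and with `−1` the full cubic group `O_h` (order 48).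

Consequences landed here:
* `noReconstructionGainAt_transport` — crux-body form, any lattice isometry `g`;
* `adhesion_transport` — atom (Finset) form, any lattice isometry `g`;
* `blanket_noReconstructionGain_bondReflection_e3` / `…_neg_…` — the blanket bound (cf-p1 g14,
  def-free as in `…BlanketGlue`) gives `NoReconstructionGain` (`R = 1`, `C = 4π`) at the mirror
  images `e₃ − 2⟪w, e₃⟫ w` of the basal normal and their negatives: together with
  `blanket_noReconstructionGain_e3 / _neg_e3` these are ALL EIGHT hexagonal `(111)`-type normals of
  `Λ₀` (for the six bonds `w` leaving the basal plane, `⟪w, e₃⟫ = ±√(2/3)` and the image has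
  basal component `−1/3`).

WHAT THIS IS NOT: no new case of the atom is proved — only its bookkeeping across the 48 lattice
symmetries (every `e₃`-rung of the line now holds at eight normals, every cube-facet rung at six);
the blanket bound itself is a conjecture (censused, unproved); rung F-C1 not moved.
-/

noncomputable section

namespace Summit.Ventures.Crystal3D.Theorems

open Summit.Ventures.Crystal3D Finset MeasureTheory
open Literature.MathematicalPhysics.StatisticalMechanics (barlowPos barlowStacking fccStacking
  constHagg barlowPos_mem mem_barlowStacking_iff orderedContacts contactDeficiency)
open scoped InnerProductSpace

/-! ### 1. The lattice is half-integral: bond mirrors and the central inversion preserve `Λ₀` -/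

/-- **Inner products of fcc sites are half-integers**, in coordinates:
`2⟪(k,i,j), (k',i',j')⟫ = 2(ii' + jj' + kk') + (ij' + i'j + ik' + i'k + jk' + j'k)`. -/
theorem two_inner_barlowPos_fcc (k i j k' i' j' : ℤ) :
    2 * ⟪barlowPos 1 (Real.sqrt (2 / 3)) constHagg k i j,
        barlowPos 1 (Real.sqrt (2 / 3)) constHagg k' i' j'⟫_ℝ =
      ((2 * (i * i' + j * j' + k * k') + (i * j' + i' * j + i * k' + i' * k + j * k' + j' * k) : ℤ) :
        ℝ) := by
  have h1 := norm_sq_barlowPos_fcc k i j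
  have h2 := norm_sq_barlowPos_fcc k' i' j'
  have h3 := norm_sq_barlowPos_fcc (k - k') (i - i') (j - j')
  rw [← barlowPos_fcc_sub, norm_sub_sq_real] at h3
  push_cast at h1 h2 h3 ⊢
  linarith

/-- For `p, q ∈ Λ₀`, `2⟪p, q⟫` is an integer. -/
theorem exists_int_two_inner_fcc {p q : EuclideanSpace ℝ (Fin 3)}
    (hp : p ∈ fccStacking 1 (Real.sqrt (2 / 3))) (hq : q ∈ fccStacking 1 (Real.sqrt (2 / 3))) :
    ∃ n : ℤ, 2 * ⟪p, q⟫_ℝ = n := by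
  obtain ⟨k, i, j, rfl⟩ := mem_barlowStacking_iff.1 hp
  obtain ⟨k', i', j', rfl⟩ := mem_barlowStacking_iff.1 hq
  exact ⟨_, two_inner_barlowPos_fcc k i j k' i' j'⟩

/-- `Λ₀` is closed under `p ↦ p − n • w` (`n ∈ ℤ`, `w ∈ Λ₀`). -/
theorem fcc_sub_zsmul_mem {p w : EuclideanSpace ℝ (Fin 3)}
    (hp : p ∈ fccStacking 1 (Real.sqrt (2 / 3))) (hw : w ∈ fccStacking 1 (Real.sqrt (2 / 3)))
    (n : ℤ) : p - (n : ℝ) • w ∈ fccStacking 1 (Real.sqrt (2 / 3)) := by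
  obtain ⟨k, i, j, rfl⟩ := mem_barlowStacking_iff.1 hp
  obtain ⟨k', i', j', rfl⟩ := mem_barlowStacking_iff.1 hw
  refine mem_barlowStacking_iff.2 ⟨k - n * k', i - n * i', j - n * j', ?_⟩
  rw [barlowPos_fcc_linear 1 _ k, barlowPos_fcc_linear 1 _ k',
    barlowPos_fcc_linear 1 _ (k - n * k')]
  push_cast
  module

/-- `Λ₀` is centrally symmetric. -/
theorem fcc_neg_mem {p : EuclideanSpace ℝ (Fin 3)} (hp : p ∈ fccStacking 1 (Real.sqrt (2 / 3))) :
    -p ∈ fccStacking 1 (Real.sqrt (2 / 3)) := by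
  obtain ⟨k, i, j, rfl⟩ := mem_barlowStacking_iff.1 hp
  exact mem_barlowStacking_iff.2 ⟨-k, -i, -j, (barlowPos_fcc_neg k i j).symm⟩

/-- The mirror orthogonal to a unit vector `w`, as a formula: `v ↦ v − 2⟪w, v⟫ w`. -/
theorem bondReflection_apply (w v : EuclideanSpace ℝ (Fin 3)) (hw : ‖w‖ = 1) :
    (ℝ ∙ w)ᗮ.reflection v = v - (2 * ⟪w, v⟫_ℝ) • w := by
  rw [Submodule.reflection_orthogonal_apply, Submodule.reflection_singleton_apply, hw]
  simp only [RCLike.ofReal_real_eq_id, id_eq, one_pow, div_one, two_smul, mul_comm (2 : ℝ),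
    mul_two, add_smul]
  abel

/-- **Bond mirrors preserve the lattice.**  For a bond vector `w ∈ Λ₀`, `‖w‖ = 1`, the mirror
orthogonal to `w` maps `Λ₀` into itself (`2⟪w, p⟫ ∈ ℤ`). -/
theorem bondReflection_mem_fcc {w : EuclideanSpace ℝ (Fin 3)}
    (hw : w ∈ fccStacking 1 (Real.sqrt (2 / 3))) (hw1 : ‖w‖ = 1) {p : EuclideanSpace ℝ (Fin 3)}
    (hp : p ∈ fccStacking 1 (Real.sqrt (2 / 3))) :
    (ℝ ∙ w)ᗮ.reflection p ∈ fccStacking 1 (Real.sqrt (2 / 3)) := by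
  rw [bondReflection_apply w p hw1]
  obtain ⟨n, hn⟩ := exists_int_two_inner_fcc hw hp
  rw [hn]
  exact fcc_sub_zsmul_mem hp hw n

/-- A bond mirror is an involution: its inverse is itself. -/
theorem bondReflection_symm (w : EuclideanSpace ℝ (Fin 3)) :
    ((ℝ ∙ w)ᗮ.reflection).symm = (ℝ ∙ w)ᗮ.reflection :=
  Submodule.reflection_symm

/-! ### 2. Invariance of the ingredients of the crux under a lattice isometry -/

/-- The unit shell of `Λ₀` is permuted by a lattice isometry. -/
theorem fccShell_eq_image (g : EuclideanSpace ℝ (Fin 3) ≃ₗᵢ[ℝ] EuclideanSpace ℝ (Fin 3))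
    (hg : ∀ p ∈ fccStacking 1 (Real.sqrt (2 / 3)), g p ∈ fccStacking 1 (Real.sqrt (2 / 3)))
    (hg' : ∀ p ∈ fccStacking 1 (Real.sqrt (2 / 3)), g.symm p ∈ fccStacking 1 (Real.sqrt (2 / 3))) :
    {w ∈ fccStacking 1 (Real.sqrt (2 / 3)) | ‖w‖ = 1} =
      g '' {w ∈ fccStacking 1 (Real.sqrt (2 / 3)) | ‖w‖ = 1} := by
  ext w
  simp only [Set.mem_setOf_eq, Set.mem_image]
  constructor
  · rintro ⟨hw, hw1⟩
    exact ⟨g.symm w, ⟨hg' w hw, by rw [LinearIsometryEquiv.norm_map, hw1]⟩, g.apply_symm_apply w⟩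
  · rintro ⟨w', ⟨hw', hw1'⟩, rfl⟩
    exact ⟨hg w' hw', by rw [LinearIsometryEquiv.norm_map]; exact hw1'⟩

/-- **`φ` is invariant**: `Σᶠ_{w ∈ Λ₀, ‖w‖=1} |⟪w, g ν⟫| = Σᶠ_{w ∈ Λ₀, ‖w‖=1} |⟪w, ν⟫|` for a lattice
isometry `g`. -/
theorem finsum_fccShell_abs_inner_map
    (g : EuclideanSpace ℝ (Fin 3) ≃ₗᵢ[ℝ] EuclideanSpace ℝ (Fin 3))
    (hg : ∀ p ∈ fccStacking 1 (Real.sqrt (2 / 3)), g p ∈ fccStacking 1 (Real.sqrt (2 / 3)))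
    (hg' : ∀ p ∈ fccStacking 1 (Real.sqrt (2 / 3)), g.symm p ∈ fccStacking 1 (Real.sqrt (2 / 3)))
    (ν : EuclideanSpace ℝ (Fin 3)) :
    ∑ᶠ w ∈ {w ∈ fccStacking 1 (Real.sqrt (2 / 3)) | ‖w‖ = 1}, |⟪w, g ν⟫_ℝ| =
      ∑ᶠ w ∈ {w ∈ fccStacking 1 (Real.sqrt (2 / 3)) | ‖w‖ = 1}, |⟪w, ν⟫_ℝ| := by
  conv_lhs => rw [fccShell_eq_image g hg hg']
  rw [finsum_mem_image g.injective.injOn]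
  refine finsum_mem_congr rfl fun w _ => ?_
  rw [LinearIsometryEquiv.inner_map_map]

/-- The contact number of a configuration is invariant under an isometry of `ℝ³`. -/
theorem numContacts_comp_linearIsometryEquiv {N : ℕ}
    (g : EuclideanSpace ℝ (Fin 3) ≃ₗᵢ[ℝ] EuclideanSpace ℝ (Fin 3))
    (x : Fin N → EuclideanSpace ℝ (Fin 3)) :
    numContacts (fun i => g (x i)) = numContacts x := by
  unfold numContacts contactPairs
  congr 1
  refine filter_congr fun p _ => ?_
  rw [LinearIsometryEquiv.dist_map]

/-- A rigid image of a unit packing is a unit packing. -/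
theorem isUnitPacking_comp_linearIsometryEquiv {N : ℕ}
    (g : EuclideanSpace ℝ (Fin 3) ≃ₗᵢ[ℝ] EuclideanSpace ℝ (Fin 3))
    {x : Fin N → EuclideanSpace ℝ (Fin 3)} (hx : IsUnitPacking x) :
    IsUnitPacking (fun i => g (x i)) := by
  intro i j hij
  rw [LinearIsometryEquiv.dist_map]
  exact hx hij

/-! ### 3. Transport of the crux body and of the atom -/

/-- **Transport of the crux body.**  Let `g` be a linear isometry of `ℝ³` mapping `Λ₀` onto
itself.  If the body of `NoReconstructionGain` holds at the normal `ν` with constants `(R, C)` —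
for every `ρ ≥ R`, every finite unit packing containing the `ν`-slab sample
`{p ∈ Λ₀ : −2R ≤ ⟪p, ν⟫ ≤ −R, ‖p‖² − ⟪p, ν⟫² ≤ ρ²}` has deficiency `≥ 2 φ(ν) π ρ² − C ρ` — then
it holds at `g ν` with the same constants. -/
theorem noReconstructionGainAt_transport :
    ∀ g : EuclideanSpace ℝ (Fin 3) ≃ₗᵢ[ℝ] EuclideanSpace ℝ (Fin 3),
    (∀ p ∈ Literature.MathematicalPhysics.StatisticalMechanics.fccStacking 1 (Real.sqrt (2 / 3)),
      g p ∈ Literature.MathematicalPhysics.StatisticalMechanics.fccStacking 1 (Real.sqrt (2 / 3))) →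
    (∀ p ∈ Literature.MathematicalPhysics.StatisticalMechanics.fccStacking 1 (Real.sqrt (2 / 3)),
      g.symm p ∈ Literature.MathematicalPhysics.StatisticalMechanics.fccStacking 1 (Real.sqrt (2 / 3))) →
    ∀ (ν : EuclideanSpace ℝ (Fin 3)) (R C : ℝ),
    (∀ ρ : ℝ, R ≤ ρ → ∀ (N : ℕ) (x : Fin N → EuclideanSpace ℝ (Fin 3)),
      Summit.Ventures.Crystal3D.IsUnitPacking x →
      (∀ p ∈ Literature.MathematicalPhysics.StatisticalMechanics.fccStacking 1 (Real.sqrt (2 / 3)),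
          -(2 * R) ≤ ⟪p, ν⟫_ℝ → ⟪p, ν⟫_ℝ ≤ -R → ‖p‖ ^ 2 - ⟪p, ν⟫_ℝ ^ 2 ≤ ρ ^ 2 → ∃ i, x i = p) →
        2 * (Real.sqrt 2 / 4 *
              ∑ᶠ w ∈ {w ∈ Literature.MathematicalPhysics.StatisticalMechanics.fccStacking 1
                (Real.sqrt (2 / 3)) | ‖w‖ = 1}, |⟪w, ν⟫_ℝ|) *
            Real.pi * ρ ^ 2 - C * ρ ≤ 6 * (N : ℝ) - (Summit.Ventures.Crystal3D.numContacts x : ℝ)) →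
    ∀ ρ : ℝ, R ≤ ρ → ∀ (N : ℕ) (x : Fin N → EuclideanSpace ℝ (Fin 3)),
      Summit.Ventures.Crystal3D.IsUnitPacking x →
      (∀ p ∈ Literature.MathematicalPhysics.StatisticalMechanics.fccStacking 1 (Real.sqrt (2 / 3)),
          -(2 * R) ≤ ⟪p, g ν⟫_ℝ → ⟪p, g ν⟫_ℝ ≤ -R → ‖p‖ ^ 2 - ⟪p, g ν⟫_ℝ ^ 2 ≤ ρ ^ 2 →
            ∃ i, x i = p) →
        2 * (Real.sqrt 2 / 4 *
              ∑ᶠ w ∈ {w ∈ Literature.MathematicalPhysics.StatisticalMechanics.fccStacking 1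
                (Real.sqrt (2 / 3)) | ‖w‖ = 1}, |⟪w, g ν⟫_ℝ|) *
            Real.pi * ρ ^ 2 - C * ρ ≤ 6 * (N : ℝ) - (Summit.Ventures.Crystal3D.numContacts x : ℝ) := by
  intro g hg hg' ν R C h ρ hρ N x hx hP
  -- pull the configuration back through `g`
  set x' : Fin N → EuclideanSpace ℝ (Fin 3) := fun i => g.symm (x i) with hx'def
  have hx' : IsUnitPacking x' := isUnitPacking_comp_linearIsometryEquiv g.symm hx
  have hP' : ∀ p ∈ fccStacking 1 (Real.sqrt (2 / 3)),
      -(2 * R) ≤ ⟪p, ν⟫_ℝ → ⟪p, ν⟫_ℝ ≤ -R → ‖p‖ ^ 2 - ⟪p, ν⟫_ℝ ^ 2 ≤ ρ ^ 2 → ∃ i, x' i = p := by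
    intro p hp h1 h2 h3
    have hi : ⟪g p, g ν⟫_ℝ = ⟪p, ν⟫_ℝ := g.inner_map_map p ν
    obtain ⟨i, hi'⟩ := hP (g p) (hg p hp) (by rw [hi]; exact h1) (by rw [hi]; exact h2)
      (by rw [hi, LinearIsometryEquiv.norm_map]; exact h3)
    exact ⟨i, by simp only [hx'def, hi', LinearIsometryEquiv.symm_apply_apply]⟩
  have hC : numContacts x' = numContacts x := numContacts_comp_linearIsometryEquiv g.symm x
  have hmain := h ρ hρ N x' hx' hP'
  rw [finsum_fccShell_abs_inner_map g hg hg', ← hC]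
  exact hmain

/-- **Transport of the atom** (the Finset form of the registered stub `stub_adhesion` at a fixed
normal and radius).  If for every finite unit packing `X ⊇ P` with `P` EXACTLY the `ν`-slab sample
`#cross(P, X∖P) ≤ contactDeficiency (X∖P) + C ρ`, then the same holds with `ν` replaced by `g ν`,
for every linear isometry `g` of `ℝ³` mapping `Λ₀` onto itself. -/
theorem adhesion_transport :
    ∀ g : EuclideanSpace ℝ (Fin 3) ≃ₗᵢ[ℝ] EuclideanSpace ℝ (Fin 3),
    (∀ p ∈ Literature.MathematicalPhysics.StatisticalMechanics.fccStacking 1 (Real.sqrt (2 / 3)),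
      g p ∈ Literature.MathematicalPhysics.StatisticalMechanics.fccStacking 1 (Real.sqrt (2 / 3))) →
    (∀ p ∈ Literature.MathematicalPhysics.StatisticalMechanics.fccStacking 1 (Real.sqrt (2 / 3)),
      g.symm p ∈ Literature.MathematicalPhysics.StatisticalMechanics.fccStacking 1 (Real.sqrt (2 / 3))) →
    ∀ (ν : EuclideanSpace ℝ (Fin 3)) (R C ρ : ℝ),
    (∀ X P : Finset (EuclideanSpace ℝ (Fin 3)), (∀ p ∈ X, ∀ q ∈ X, p ≠ q → 1 ≤ dist p q) →
      P ⊆ X →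
      (∀ p, p ∈ P ↔ (p ∈ Literature.MathematicalPhysics.StatisticalMechanics.fccStacking 1
        (Real.sqrt (2 / 3)) ∧ -(2 * R) ≤ ⟪p, ν⟫_ℝ ∧ ⟪p, ν⟫_ℝ ≤ -R ∧ ‖p‖ ^ 2 - ⟪p, ν⟫_ℝ ^ 2 ≤ ρ ^ 2)) →
      ((((P ×ˢ (X \ P)).filter fun pq => dist pq.1 pq.2 = 1).card : ℕ) : ℝ) ≤
        Literature.MathematicalPhysics.StatisticalMechanics.contactDeficiency (X \ P) + C * ρ) →
    ∀ X P : Finset (EuclideanSpace ℝ (Fin 3)), (∀ p ∈ X, ∀ q ∈ X, p ≠ q → 1 ≤ dist p q) →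
      P ⊆ X →
      (∀ p, p ∈ P ↔ (p ∈ Literature.MathematicalPhysics.StatisticalMechanics.fccStacking 1
        (Real.sqrt (2 / 3)) ∧ -(2 * R) ≤ ⟪p, g ν⟫_ℝ ∧ ⟪p, g ν⟫_ℝ ≤ -R ∧
        ‖p‖ ^ 2 - ⟪p, g ν⟫_ℝ ^ 2 ≤ ρ ^ 2)) →
      ((((P ×ˢ (X \ P)).filter fun pq => dist pq.1 pq.2 = 1).card : ℕ) : ℝ) ≤
        Literature.MathematicalPhysics.StatisticalMechanics.contactDeficiency (X \ P) + C * ρ := by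
  classical
  intro g hg hg' ν R C ρ h X P hX hPX hP
  have hgi : Isometry (g.symm : EuclideanSpace ℝ (Fin 3) → EuclideanSpace ℝ (Fin 3)) :=
    g.symm.isometry
  have hinj : Function.Injective (g.symm : EuclideanSpace ℝ (Fin 3) → EuclideanSpace ℝ (Fin 3)) :=
    g.symm.injective
  set X' := X.image g.symm with hX'
  set P' := P.image g.symm with hP'def
  have hsd : X' \ P' = (X \ P).image g.symm := by
    rw [hX', hP'def, image_sdiff_of_injOn hinj.injOn hPX]
  have hXp : ∀ p ∈ X', ∀ q ∈ X', p ≠ q → 1 ≤ dist p q := by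
    intro p hp q hq hpq
    obtain ⟨p₀, hp₀, rfl⟩ := mem_image.1 hp
    obtain ⟨q₀, hq₀, rfl⟩ := mem_image.1 hq
    rw [hgi.dist_eq]
    exact hX p₀ hp₀ q₀ hq₀ fun e => hpq (by rw [e])
  have hPXp : P' ⊆ X' := image_subset_image hPX
  have hinn : ∀ p, ⟪g.symm p, ν⟫_ℝ = ⟪p, g ν⟫_ℝ := fun p => by
    rw [← g.inner_map_map (g.symm p) ν, LinearIsometryEquiv.apply_symm_apply]
  have hPp : ∀ p, p ∈ P' ↔ (p ∈ fccStacking 1 (Real.sqrt (2 / 3)) ∧ -(2 * R) ≤ ⟪p, ν⟫_ℝ ∧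
      ⟪p, ν⟫_ℝ ≤ -R ∧ ‖p‖ ^ 2 - ⟪p, ν⟫_ℝ ^ 2 ≤ ρ ^ 2) := by
    intro p
    rw [hP'def, mem_image]
    constructor
    · rintro ⟨p₀, hp₀, rfl⟩
      obtain ⟨hΛ, h1, h2, h3⟩ := (hP p₀).1 hp₀
      refine ⟨hg' p₀ hΛ, ?_, ?_, ?_⟩
      · rw [hinn]; exact h1
      · rw [hinn]; exact h2
      · rw [hinn, LinearIsometryEquiv.norm_map]; exact h3
    · rintro ⟨hΛ, h1, h2, h3⟩
      have hi : ⟪g p, g ν⟫_ℝ = ⟪p, ν⟫_ℝ := g.inner_map_map p ν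
      refine ⟨g p, (hP (g p)).2 ⟨hg p hΛ, ?_, ?_, ?_⟩, g.symm_apply_apply p⟩
      · rw [hi]; exact h1
      · rw [hi]; exact h2
      · rw [hi, LinearIsometryEquiv.norm_map]; exact h3
  have hmain := h X' P' hXp hPXp hPp
  rw [hsd, hP'def, card_cross_image_of_isometry hgi, contactDeficiency_image_of_isometry hgi]
    at hmain
  exact hmain

/-! ### 4. The blanket bound reaches all eight hexagonal normals -/

/-- **`BlanketBound ⇒ NoReconstructionGain` at the mirror images of the basal normal.**  For every
bond vector `w ∈ Λ₀` (`‖w‖ = 1`), the blanket bound (def-free, as in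
`blanket_noReconstructionGain_e3`) implies the crux body at `ν = e₃ − 2⟪w, e₃⟫ w` with `R = 1`,
`C = 4π`.  For the six bonds leaving the basal plane these are the normals of the three oblique
`{111}` plane families of `Λ₀` (basal component `−1/3`); for the six basal bonds `ν = e₃`. -/
theorem blanket_noReconstructionGain_bondReflection_e3 :
    (∀ (N : ℕ) (x : Fin N → EuclideanSpace ℝ (Fin 3)), Summit.Ventures.Crystal3D.IsUnitPacking x →
      ∀ ν : EuclideanSpace ℝ (Fin 3), ‖ν‖ = 1 →
        2 * Real.sqrt 3 * (MeasureTheory.volume {y : EuclideanSpace ℝ (Fin 3) |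
          (∃ i, ‖y - x i‖ ^ 2 - ⟪y - x i, ν⟫_ℝ ^ 2 ≤ (Real.sqrt 3)⁻¹ ^ 2) ∧
          |⟪y, ν⟫_ℝ| ≤ 1 / 2}).toReal ≤ 6 * (N : ℝ) - (Summit.Ventures.Crystal3D.numContacts x : ℝ)) →
    ∀ w ∈ Literature.MathematicalPhysics.StatisticalMechanics.fccStacking 1 (Real.sqrt (2 / 3)),
    ‖w‖ = 1 →
    ∃ R C : ℝ, 0 < R ∧ ∀ ρ : ℝ, R ≤ ρ →
      ∀ (N : ℕ) (x : Fin N → EuclideanSpace ℝ (Fin 3)), Summit.Ventures.Crystal3D.IsUnitPacking x →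
        (∀ p ∈ Literature.MathematicalPhysics.StatisticalMechanics.fccStacking 1 (Real.sqrt (2 / 3)),
            -(2 * R) ≤ ⟪p, (ℝ ∙ w)ᗮ.reflection (EuclideanSpace.single (2 : Fin 3) (1 : ℝ))⟫_ℝ →
            ⟪p, (ℝ ∙ w)ᗮ.reflection (EuclideanSpace.single (2 : Fin 3) (1 : ℝ))⟫_ℝ ≤ -R →
            ‖p‖ ^ 2 - ⟪p, (ℝ ∙ w)ᗮ.reflection (EuclideanSpace.single (2 : Fin 3) (1 : ℝ))⟫_ℝ ^ 2
              ≤ ρ ^ 2 → ∃ i, x i = p) →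
          2 * (Real.sqrt 2 / 4 *
                ∑ᶠ w' ∈ {w' ∈ Literature.MathematicalPhysics.StatisticalMechanics.fccStacking 1
                  (Real.sqrt (2 / 3)) | ‖w'‖ = 1},
                  |⟪w', (ℝ ∙ w)ᗮ.reflection (EuclideanSpace.single (2 : Fin 3) (1 : ℝ))⟫_ℝ|) *
              Real.pi * ρ ^ 2 - C * ρ ≤
            6 * (N : ℝ) - (Summit.Ventures.Crystal3D.numContacts x : ℝ) := by
  intro hB w hw hw1
  obtain ⟨R, C, hR, h⟩ := blanket_noReconstructionGain_e3 hB
  refine ⟨R, C, hR, ?_⟩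
  have hg : ∀ p ∈ fccStacking 1 (Real.sqrt (2 / 3)),
      (ℝ ∙ w)ᗮ.reflection p ∈ fccStacking 1 (Real.sqrt (2 / 3)) :=
    fun p hp => bondReflection_mem_fcc hw hw1 hp
  have hg' : ∀ p ∈ fccStacking 1 (Real.sqrt (2 / 3)),
      ((ℝ ∙ w)ᗮ.reflection).symm p ∈ fccStacking 1 (Real.sqrt (2 / 3)) := by
    intro p hp; rw [bondReflection_symm]; exact hg p hp
  exact noReconstructionGainAt_transport _ hg hg' _ R C h

/-- The same at the negatives `−(e₃ − 2⟪w, e₃⟫ w)` (transport along the bond mirror composed with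
the central inversion); with `w` running over the bonds this covers the remaining four hexagonal
normals. -/
theorem blanket_noReconstructionGain_neg_bondReflection_e3 :
    (∀ (N : ℕ) (x : Fin N → EuclideanSpace ℝ (Fin 3)), Summit.Ventures.Crystal3D.IsUnitPacking x →
      ∀ ν : EuclideanSpace ℝ (Fin 3), ‖ν‖ = 1 →
        2 * Real.sqrt 3 * (MeasureTheory.volume {y : EuclideanSpace ℝ (Fin 3) |
          (∃ i, ‖y - x i‖ ^ 2 - ⟪y - x i, ν⟫_ℝ ^ 2 ≤ (Real.sqrt 3)⁻¹ ^ 2) ∧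
          |⟪y, ν⟫_ℝ| ≤ 1 / 2}).toReal ≤ 6 * (N : ℝ) - (Summit.Ventures.Crystal3D.numContacts x : ℝ)) →
    ∀ w ∈ Literature.MathematicalPhysics.StatisticalMechanics.fccStacking 1 (Real.sqrt (2 / 3)),
    ‖w‖ = 1 →
    ∃ R C : ℝ, 0 < R ∧ ∀ ρ : ℝ, R ≤ ρ →
      ∀ (N : ℕ) (x : Fin N → EuclideanSpace ℝ (Fin 3)), Summit.Ventures.Crystal3D.IsUnitPacking x →
        (∀ p ∈ Literature.MathematicalPhysics.StatisticalMechanics.fccStacking 1 (Real.sqrt (2 / 3)),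
            -(2 * R) ≤ ⟪p, -(ℝ ∙ w)ᗮ.reflection (EuclideanSpace.single (2 : Fin 3) (1 : ℝ))⟫_ℝ →
            ⟪p, -(ℝ ∙ w)ᗮ.reflection (EuclideanSpace.single (2 : Fin 3) (1 : ℝ))⟫_ℝ ≤ -R →
            ‖p‖ ^ 2 - ⟪p, -(ℝ ∙ w)ᗮ.reflection (EuclideanSpace.single (2 : Fin 3) (1 : ℝ))⟫_ℝ ^ 2
              ≤ ρ ^ 2 → ∃ i, x i = p) →
          2 * (Real.sqrt 2 / 4 *
                ∑ᶠ w' ∈ {w' ∈ Literature.MathematicalPhysics.StatisticalMechanics.fccStacking 1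
                  (Real.sqrt (2 / 3)) | ‖w'‖ = 1},
                  |⟪w', -(ℝ ∙ w)ᗮ.reflection (EuclideanSpace.single (2 : Fin 3) (1 : ℝ))⟫_ℝ|) *
              Real.pi * ρ ^ 2 - C * ρ ≤
            6 * (N : ℝ) - (Summit.Ventures.Crystal3D.numContacts x : ℝ) := by
  intro hB w hw hw1
  obtain ⟨R, C, hR, h⟩ := blanket_noReconstructionGain_bondReflection_e3 hB w hw hw1
  refine ⟨R, C, hR, ?_⟩
  have hg : ∀ p ∈ fccStacking 1 (Real.sqrt (2 / 3)),
      LinearIsometryEquiv.neg ℝ p ∈ fccStacking 1 (Real.sqrt (2 / 3)) :=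
    fun p hp => fcc_neg_mem hp
  have hg' : ∀ p ∈ fccStacking 1 (Real.sqrt (2 / 3)),
      (LinearIsometryEquiv.neg ℝ (E := EuclideanSpace ℝ (Fin 3))).symm p ∈
        fccStacking 1 (Real.sqrt (2 / 3)) :=
    fun p hp => fcc_neg_mem hp
  exact noReconstructionGainAt_transport _ hg hg' _ R C h

end Summit.Ventures.Crystal3D.Theorems
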